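/-
Speedrun cell sr-mbsolver / programme hubbard-alg — LIT team (lit-1 gen-18), for the RAWLOW rows with STAGGERED charge components
(FORMAT-ksdn v0.6 'staggered charge components' R1–R6, presentation (α) of the FORMAT pen l3-eng-3, HOME/INBOX l.10421: ONE-site
cell, bond label a PAIR, the second component with the INVOLUTIVE bond rule `u_b = κ − u_a − m(s)`; first signed rows CERTIFIED
#355 / #381 / #399 (U = 8), #405 (U = 6), #430 (U = 4), #436 / #437 (U = 16 / 12)): lane-B / L3-D6 transport, PRIMAL form,
MODEL-INDEPENDENT core with SITE-INDEXED charges. Theorem-only.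
HONEST FRAMING: first certified bounds; not a superconductivity verdict; every number certified or labelled float.

WHAT THIS GIVES. `exists_mpsRawRowsTr_of_window_loewner_at` = `Transport/MPSPrimalRawWindow.lean`'s
`exists_mpsRawRowsTr_of_window_loewner` with the translation-invariant additive charge (`qs : Fin q → G`, `qb : β → G`,
`A^s_{ab} ≠ 0 ⇒ qb b = qb a + qs s`) replaced by SITE-INDEXED families `qs : ℕ → Fin q → G`, `qb : ℕ → β → G` with
`A^s_{ab} ≠ 0 ⇒ qb (x+1) b = qb x a + qs x s` at every position `x` (`Literature/…/MPSCoarseGrainingSectorsAt.lean`): given a real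
MPS tensor `A` so covariant, a-priori bounds `B_m ≥ 0` with `W_{m−2}ᴴ W_{m−2} ≤ B_m·𝟙`, and an `N = m'+2 ≥ j+2`-site window variable
`ρ ⪰ 0` with `tr ρ = 1`, `tr_L ρ = tr_R ρ`, block diagonal in the POSITION-WEIGHTED total charge `Σ_x qs x (u_x)` and entrywise real,
the family `ω_m = C_{m−2}(ρ|_{first m})` satisfies every `ω`-row of the `mps-rawlow` relaxation (E_{j+2}L/R, E_mL/E_mR, `ω_m ⪰ 0`,
real entries, `|ω_m| ≤ B_m`, `Re tr ω_m ≤ B_m`) AND the site-indexed sector zeros `cgTagAt qs qb 0 (m−2)` — for the staggered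
component exactly the parity-of-`m` tags of FORMAT-ksdn v0.6 R3 (`covariantAt_of_involutive`). The proof is the text of the
translation-invariant theorem with `cgState_apply_eq_zero_of_cgTagAt_ne` / `headMarginal_apply_eq_zero_of_chargeAt` in the sector
clause; the window-side staggered sector zeros themselves are supplied by the sector-compression (twirl) step of the next file.
No model, no definition, no `sorry`, no new axiom, no named fact.
[cite: KullEtAl2024, §2.3–2.5 eqs. (TNoneStepRelaxation), (TNfullRelax5); §3.3; §4.2 eqs. (MPSextension), (relaxLocTIn)]
[cite: PerezGarciaVerstraeteWolfCirac2007, §3.2] [cite: HornJohnson2013, Theorem 5.1.4, §5.6]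
-/
import Summits.Ventures.CertifiedManyBodySolver.Transport.MPSPrimalRawWindow
import Literature.MathematicalPhysics.QuantumLattice.MPSCoarseGrainingSectorsAt
import HarnessLib

noncomputable section

open Matrix Complex Filter Topology
open scoped ComplexOrder Kronecker BigOperators MatrixOrder
open Literature.Probability.LatticeModels
open Literature.MathematicalPhysics.QuantumLattice
open Literature.MathematicalPhysics.QuantumLattice.HubbardWave0
open Literature.MathematicalPhysics.QuantumLattice.ThermodynamicLimit
open Literature.MathematicalPhysics.QuantumLattice.JordanWigner
open Literature.MathematicalPhysics.QuantumManyBody.StateRelaxation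
open Literature.MathematicalPhysics.QuantumLattice.MPSCoarseGraining
open Literature.Computability.QuantumComplexity (traceLeft traceRight)

namespace Summit.Ventures.CertifiedManyBodySolver.Transport

/-! ### Site-indexed charge sectors are inherited by marginals -/

section ChargesAt

variable {X Y G : Type*} [Fintype X] [DecidableEq X] [Fintype Y] [DecidableEq Y] [AddCancelCommMonoid G] {q : ℕ}

omit [DecidableEq X] [DecidableEq Y] in
/-- Two configurations that agree off the range of `φ` have position-weighted total charges (site charge tables `c_y`)
that differ exactly by the charges read through `φ`: `Q(u) + Q_φ(v ∘ φ) = Q(v) + Q_φ(u ∘ φ)`. [cite: KullEtAl2024, §3.3] -/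
theorem sum_chargeAt_add_eq_of_agree (c : Y → Fin q → G) (φ : X ↪ Y) {u v : TensorIndex Y q}
    (h : ∀ y, y ∉ Set.range φ → u y = v y) :
    (∑ y, c y (u y)) + ∑ x, c (φ x) (v (φ x)) = (∑ y, c y (v y)) + ∑ x, c (φ x) (u (φ x)) := by
  classical
  have split : ∀ w : TensorIndex Y q, ∑ y, c y (w y) =
      (∑ x, c (φ x) (w (φ x))) + ∑ y ∈ Finset.univ.filter (fun y => y ∉ Set.range φ), c y (w y) := by
    intro w
    rw [← Finset.sum_filter_add_sum_filter_not Finset.univ (fun y => y ∈ Set.range φ)]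
    congr 1
    have hset : Finset.univ.filter (fun y => y ∈ Set.range φ) = Finset.univ.map φ := by
      ext y
      simp only [Finset.mem_filter, Finset.mem_univ, true_and, Finset.mem_map, Set.mem_range]
    rw [hset, Finset.sum_map]
  have hoff : ∑ y ∈ Finset.univ.filter (fun y => y ∉ Set.range φ), c y (u y) =
      ∑ y ∈ Finset.univ.filter (fun y => y ∉ Set.range φ), c y (v y) :=
    Finset.sum_congr rfl fun y hy => by rw [h y (Finset.mem_filter.1 hy).2]
  rw [split u, split v, hoff]
  abel

/-- **Site-indexed sector zeros are inherited by marginals.** If `σ ∈ 𝔄_Y` vanishes between product-basis configurations of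
different position-weighted total charge `Σ_y c_y(·_y)`, so does every partial trace `tr_φ σ` for the charge tables read through
`φ` (the traced-out sites carry the same configuration on both sides). [cite: KullEtAl2024, §3.3 (symmetry sectors of the window
variables)] -/
theorem spinPartialTrace_apply_eq_zero_of_chargeAt (c : Y → Fin q → G) (φ : X ↪ Y) {σ : Op Y q}
    (hσ : ∀ u v : TensorIndex Y q, (∑ y, c y (u y)) ≠ (∑ y, c y (v y)) → σ u v = 0) {t s : TensorIndex X q}
    (hts : (∑ x, c (φ x) (t x)) ≠ (∑ x, c (φ x) (s x))) : spinPartialTrace φ σ t s = 0 := by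
  rw [spinPartialTrace_apply, Matrix.trace]
  refine Finset.sum_eq_zero fun a _ => ?_
  rw [Matrix.diag_apply, Matrix.mul_apply]
  refine Finset.sum_eq_zero fun b _ => ?_
  rw [spinEmbed_apply]
  split_ifs with hab
  · rw [Matrix.single_apply]
    split_ifs with hst
    · obtain ⟨h1, h2⟩ := hst
      have hzero : σ b a = 0 := by
        refine hσ b a fun hba => hts ?_
        have key := sum_chargeAt_add_eq_of_agree c φ hab
        rw [hba] at key
        have key' := add_left_cancel key
        rw [h1, h2]
        exact key'
      rw [hzero, mul_zero]
    · rw [zero_mul]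
  · rw [zero_mul]

/-- Head marginals inherit the site-indexed charge sectors (the first `m` sites keep their positions).
[cite: KullEtAl2024, §3.3] -/
theorem headMarginal_apply_eq_zero_of_chargeAt (c : ℕ → Fin q → G) {N m : ℕ} (h : m ≤ N) {ρ : Op (Fin N) q}
    (hρ : ∀ u v : TensorIndex (Fin N) q, (∑ y : Fin N, c (y : ℕ) (u y)) ≠ (∑ y : Fin N, c (y : ℕ) (v y)) → ρ u v = 0)
    {t s : TensorIndex (Fin m) q} (hts : (∑ x : Fin m, c (x : ℕ) (t x)) ≠ (∑ x : Fin m, c (x : ℕ) (s x))) :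
    headMarginal h ρ t s = 0 :=
  spinPartialTrace_apply_eq_zero_of_chargeAt (fun y : Fin N => c (y : ℕ)) (Fin.castLEEmb h) hρ
    (by simpa only [Fin.castLEEmb_apply, Fin.val_castLE] using hts)

end ChargesAt

/-! ### KSDN's feasible point with a raw head block of `j + 1` sites, site-indexed charge sectors -/

section Window

variable {β G : Type*} [Fintype β] [DecidableEq β] [AddCommGroup G] {q : ℕ}

/-- **KSDN's feasible point, model-independent core, RAW LEVEL `j + 1`, `λ_max` (Löwner) bound rule, SITE-INDEXED charge
sectors** (`N = m'+2 ≥ j+2` sites, `j ≥ 2`). Given a real MPS tensor `A` covariant for site-indexed charges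
(`A^s_{ab} ≠ 0 ⇒ qb (x+1) b = qb x a + qs x s`), a-priori bounds `B_m` with `0 ≤ B_m` and `W_{m−2}ᴴ W_{m−2} ≤ B_m·𝟙`
(`m = k+j+2 ≤ N`), and a window variable `ρ ⪰ 0`, `tr ρ = 1`, `tr_L ρ = tr_R ρ`, block diagonal in the position-weighted total
charge `Σ_x qs x (·_x)`, entrywise real — there is a family `ω` such that, with `ρ_{j+1} := ρ|_{first j+1}`: E_{j+2}L, E_{j+2}R
(injection `W_j = cgMap A j`), E_mL / E_mR (`m = k+j+3 ≤ N`), `ω_m ⪰ 0`, the site-indexed sector zeros `cgTagAt qs qb 0 (m−2)`,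
real entries, `|ω_m| ≤ B_m` and `Re tr ω_m ≤ B_m` (`m = k+j+2 ≤ N`). The witness is `ω_m = C_{m−2}(ρ|_{first m})`.
[cite: KullEtAl2024, §2.3–2.5, §3.3, §4.2 eqs. (MPSextension), (relaxLocTIn)] [cite: PerezGarciaVerstraeteWolfCirac2007, §3.2] -/
theorem exists_mpsRawRowsTr_of_window_loewner_at (j m' : ℕ) (hj : 2 ≤ j) (hjm : j ≤ m') (A : Fin q → Matrix β β ℂ)
    (hAreal : ∀ s a b, star (A s a b) = A s a b) (qs : ℕ → Fin q → G) (qb : ℕ → β → G)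
    (hAcov : ∀ x s a b, A s a b ≠ 0 → qb (x + 1) b = qb x a + qs x s)
    (B : ℕ → ℝ) (hB : ∀ k, k + (j + 2) ≤ m' + 2 → 0 ≤ B (k + (j + 2)) ∧
      (cgMap A (k + j))ᴴ * cgMap A (k + j) ≤ B (k + (j + 2)) • (1 : Matrix (Fin (k + j) → Fin q) (Fin (k + j) → Fin q) ℂ))
    (ρ : Op (Fin (m' + 2)) q) (hpsd : ρ.PosSemidef) (htr : ρ.trace = 1)
    (hLTI : spinPartialTrace (Fin.succEmb (m' + 1)) ρ = spinPartialTrace Fin.castSuccEmb ρ)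
    (hsec : ∀ u v : TensorIndex (Fin (m' + 2)) q,
      (∑ x : Fin (m' + 2), qs (x : ℕ) (u x)) ≠ (∑ x : Fin (m' + 2), qs (x : ℕ) (v x)) → ρ u v = 0)
    (hstar : ∀ u v : TensorIndex (Fin (m' + 2)) q, star (ρ u v) = ρ u v) :
    ∃ ω : ℕ → Matrix (Fin q × ((β × β) × Fin q)) (Fin q × ((β × β) × Fin q)) ℂ,
      traceLeft (ω (j + 2)) = (cgMap A j ⊗ₖ (1 : Matrix (Fin q) (Fin q) ℂ)) *
          (headMarginal (show j + 1 ≤ m' + 2 by omega) ρ).submatrix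
            ((Equiv.prodComm _ _).trans (Fin.snocEquiv fun _ => Fin q))
            ((Equiv.prodComm _ _).trans (Fin.snocEquiv fun _ => Fin q)) *
        (cgMap A j ⊗ₖ (1 : Matrix (Fin q) (Fin q) ℂ))ᴴ ∧
      traceRight ((ω (j + 2)).submatrix (Equiv.prodAssoc _ _ _) (Equiv.prodAssoc _ _ _)) =
        ((1 : Matrix (Fin q) (Fin q) ℂ) ⊗ₖ cgMap A j) *
          (headMarginal (show j + 1 ≤ m' + 2 by omega) ρ).submatrix (Fin.consEquiv fun _ => Fin q)
            (Fin.consEquiv fun _ => Fin q) *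
        ((1 : Matrix (Fin q) (Fin q) ℂ) ⊗ₖ cgMap A j)ᴴ ∧
      (∀ k, k + (j + 3) ≤ m' + 2 → traceLeft (ω (k + (j + 3))) =
        (leftMap A ⊗ₖ (1 : Matrix (Fin q) (Fin q) ℂ)) *
          (ω (k + (j + 2))).submatrix (Equiv.prodAssoc _ _ _) (Equiv.prodAssoc _ _ _) *
        (leftMap A ⊗ₖ (1 : Matrix (Fin q) (Fin q) ℂ))ᴴ) ∧
      (∀ k, k + (j + 3) ≤ m' + 2 → traceRight ((ω (k + (j + 3))).submatrix (Equiv.prodAssoc _ _ _) (Equiv.prodAssoc _ _ _)) =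
        ((1 : Matrix (Fin q) (Fin q) ℂ) ⊗ₖ rightMap A) * ω (k + (j + 2)) *
        ((1 : Matrix (Fin q) (Fin q) ℂ) ⊗ₖ rightMap A)ᴴ) ∧
      (∀ k, k + (j + 2) ≤ m' + 2 → (ω (k + (j + 2))).PosSemidef) ∧
      (∀ k, k + (j + 2) ≤ m' + 2 → ∀ i i', cgTagAt qs qb 0 (k + j) i ≠ cgTagAt qs qb 0 (k + j) i' → ω (k + (j + 2)) i i' = 0) ∧
      (∀ k, k + (j + 2) ≤ m' + 2 → ∀ i i', starRingEnd ℂ (ω (k + (j + 2)) i i') = ω (k + (j + 2)) i i') ∧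
      (∀ k, k + (j + 2) ≤ m' + 2 → ∀ i i', ‖ω (k + (j + 2)) i i'‖ ≤ B (k + (j + 2))) ∧
      (∀ k, k + (j + 2) ≤ m' + 2 → ((ω (k + (j + 2))).trace).re ≤ B (k + (j + 2))) := by
  classical
  have hj1 : j + 1 ≤ m' + 2 := by omega
  have hj2 : j + 2 ≤ m' + 2 := by omega
  -- head marginals: states, real, sectored (site-indexed)
  have hHpsd : ∀ {m} (h : m ≤ m' + 2), (headMarginal h ρ).PosSemidef := fun h => posSemidef_headMarginal h hpsd
  have hHtr : ∀ {m} (h : m ≤ m' + 2), (headMarginal h ρ).trace = 1 := fun h => by rw [trace_headMarginal, htr]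
  have hHstar : ∀ {m} (h : m ≤ m' + 2) (t s : TensorIndex (Fin m) q),
      star (headMarginal h ρ t s) = headMarginal h ρ t s := fun h t s => star_headMarginal_apply hstar h t s
  have hHsec : ∀ {m} (h : m ≤ m' + 2) (u v : TensorIndex (Fin m) q),
      (∑ x : Fin m, qs (0 + (x : ℕ)) (u x)) ≠ (∑ x : Fin m, qs (0 + (x : ℕ)) (v x)) → headMarginal h ρ u v = 0 := by
    intro m h u v huv
    simp only [zero_add] at huv
    exact headMarginal_apply_eq_zero_of_chargeAt qs h hsec huv
  -- the witness `ω_m = C_{m-2}(ρ|_m)` for `j+2 ≤ m ≤ m'+2`, zero elsewhere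
  set ω : ℕ → Matrix (Fin q × ((β × β) × Fin q)) (Fin q × ((β × β) × Fin q)) ℂ :=
    fun m => if h : j + 2 ≤ m ∧ m ≤ m' + 2 then
      cgState A (m - 2) (headMarginal (show m - 2 + 2 ≤ m' + 2 by omega) ρ) else 0 with hωdef
  have hωj' : ω (j + 2) = cgState A j (headMarginal hj2 ρ) :=
    dif_pos (show j + 2 ≤ j + 2 ∧ j + 2 ≤ m' + 2 from ⟨le_rfl, hj2⟩)
  have hωj : ∀ k (hk : k + (j + 2) ≤ m' + 2), ω (k + (j + 2)) = cgState A (k + j) (headMarginal hk ρ) := fun k hk =>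
    dif_pos (show j + 2 ≤ k + (j + 2) ∧ k + (j + 2) ≤ m' + 2 from ⟨by omega, hk⟩)
  have hωj3 : ∀ k (hk : k + (j + 3) ≤ m' + 2), ω (k + (j + 3)) = cgState A (k + j + 1) (headMarginal hk ρ) := fun k hk =>
    dif_pos (show j + 2 ≤ k + (j + 3) ∧ k + (j + 3) ≤ m' + 2 from ⟨by omega, hk⟩)
  refine ⟨ω, ?_, ?_, ?_, ?_, ?_, ?_, ?_, ?_, ?_⟩
  · -- E_{j+2}L: `tr_L ρ_{j+2} = ρ_{j+1}` by LTI
    have e2 : spinPartialTrace (Fin.succEmb (j + 1)) (headMarginal hj2 ρ) = headMarginal hj1 ρ :=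
      spinPartialTrace_succEmb_headMarginal hLTI (show j + 1 ≤ m' + 1 by omega)
    calc traceLeft (ω (j + 2)) = traceLeft (cgState A j (headMarginal hj2 ρ)) := by rw [hωj']
      _ = (cgMap A j ⊗ₖ (1 : Matrix (Fin q) (Fin q) ℂ)) *
            (spinPartialTrace (Fin.succEmb (j + 1)) (headMarginal hj2 ρ)).submatrix
              ((Equiv.prodComm _ _).trans (Fin.snocEquiv fun _ => Fin q))
              ((Equiv.prodComm _ _).trans (Fin.snocEquiv fun _ => Fin q)) *
          (cgMap A j ⊗ₖ (1 : Matrix (Fin q) (Fin q) ℂ))ᴴ := traceLeft_cgState A j _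
      _ = _ := by rw [e2]
  · -- E_{j+2}R: `tr_R ρ_{j+2} = ρ_{j+1}`
    have e2 : spinPartialTrace Fin.castSuccEmb (headMarginal hj2 ρ) = headMarginal hj1 ρ :=
      spinPartialTrace_castSuccEmb_headMarginal hj2 ρ
    calc traceRight ((ω (j + 2)).submatrix (Equiv.prodAssoc _ _ _) (Equiv.prodAssoc _ _ _))
        = traceRight ((cgState A j (headMarginal hj2 ρ)).submatrix (Equiv.prodAssoc _ _ _) (Equiv.prodAssoc _ _ _)) := by
          rw [hωj']
      _ = ((1 : Matrix (Fin q) (Fin q) ℂ) ⊗ₖ cgMap A j) *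
            (spinPartialTrace Fin.castSuccEmb (headMarginal hj2 ρ)).submatrix (Fin.consEquiv fun _ => Fin q)
              (Fin.consEquiv fun _ => Fin q) *
          ((1 : Matrix (Fin q) (Fin q) ℂ) ⊗ₖ cgMap A j)ᴴ := traceRight_cgState_submatrix_prodAssoc A j _
      _ = _ := by rw [e2]
  · -- E_mL
    intro k hk3
    have hk2 : k + (j + 2) ≤ m' + 2 := by omega
    have hkM : k + j + 2 ≤ m' + 1 := by omega
    rw [hωj3 k hk3, hωj k hk2]
    exact traceLeft_cgState_headMarginal A (k + j) hLTI hkM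
  · -- E_mR
    intro k hk3
    have hk2 : k + (j + 2) ≤ m' + 2 := by omega
    have hkM : k + j + 2 ≤ m' + 1 := by omega
    rw [hωj3 k hk3, hωj k hk2]
    exact traceRight_cgState_headMarginal A (k + j) ρ hkM
  · -- PSD
    intro k hk
    rw [hωj k hk]
    exact posSemidef_cgState A (k + j) (hHpsd hk)
  · -- site-indexed sectors
    intro k hk i i' hii'
    rw [hωj k hk]
    exact cgState_apply_eq_zero_of_cgTagAt_ne (qs := qs) hAcov 0 (k + j) (hHsec hk) i i' hii'
  · -- real entries
    intro k hk i i'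
    rw [hωj k hk, starRingEnd_apply]
    exact star_cgState_apply hAreal (k + j) (hHstar hk) i i'
  · -- a-priori bounds, `λ_max` rule
    intro k hk i i'
    rw [hωj k hk]
    exact norm_cgState_apply_le_of_loewner A (k + j) (hHpsd hk) (hHtr hk) (hB k hk).1 (hB k hk).2 i i'
  · -- trace bounds `Re tr ω_m ≤ r_m` from `W_{m-2}ᴴ W_{m-2} ≤ r_m·𝟙`
    intro k hk
    rw [hωj k hk]
    exact re_trace_cgState_le_of_loewner A (k + j) (hHpsd hk) (hHtr hk) (hB k hk).1 (hB k hk).2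

end Window

end Summit.Ventures.CertifiedManyBodySolver.Transport

end
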